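import Mathlib

/-!
# Tier 3, T3.2 — R-B (FINDING 2, §A15 (i) / ADDENDUM-3 §A16 (b)–(b′)): the splitting `Z⁻ ≅ Δ × Γ⁻`
(seat t3-p3, gen 5; blind re-derivation cell `pub-hodge-repro`; paper: proofs/t3-p3/R2-PINNING-ADDENDUM-3.md §A16 (b))

FINDING 2 (i) divides a character `ψ₁` of the anticyclotomic Galois group `Z⁻` by its torsion part.  The kernel
module `Tier3TorsionKill` does that on an ABSTRACT splitting `e : G ≃* Δ × Γ` and records in its HONESTY note that
«the existence of the splitting `Z⁻ ≅ Δ × Γ⁻` (structure of finitely generated profinite abelian groups) … is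
paper (§A16)».  This file supplies that splitting for the `p`-part, which is the whole content of the paper
sentence once the prime-to-`p` part of `Z⁻` is known to be finite: a finitely generated `ℤ_p`-module is the product
of its (finite) torsion submodule and a free module of finite rank.

* `exists_linearEquiv_torsion_prod_fin` — over any PID `R`, a finitely generated module `M` is `R`-linearly
  isomorphic to `torsion R M × (Fin n → R)` for some `n` (the right-split exact sequence
  `0 → torsion → M → M/torsion → 0`, the quotient being free of finite rank);
* `snd_eq_zero_of_mem_torsion` — under ANY such isomorphism `M ≃ₗ A × B` with `B` torsion-free the torsion of `M`
  lands in the first factor: `(e x).2 = 0` for `x ∈ torsion R M` (the hypothesis `hI` of `Tier3TorsionKill`'s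
  point-of-care lemmas);
* `finite_quotient_span_pow`, `finite_quotient_span_irreducible_pow` — `ℤ_p / (q^e)` is finite for every
  irreducible `q` of `ℤ_p` (`q ~ p`, and `ℤ_p/(p^e) ≅ ℤ/p^e`);
* `finite_torsion` — the torsion submodule of a finitely generated `ℤ_p`-module is FINITE (Noetherian ⇒ finitely
  generated torsion ⇒ a finite direct sum of finite cyclic modules, Mathlib's structure theorem);
* `exists_mulEquiv_multiplicative_torsion_prod_fin` — the multiplicative form consumed by `Tier3TorsionKill`:
  `Multiplicative M ≃* Multiplicative (torsion ℤ_p M) × Multiplicative (Fin n → ℤ_p)` with the first factor finite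
  and the second torsion-free (`Δ` finite, `Γ⁻ ≅ ℤ_p^n`).

HONESTY.  Pure module theory on Mathlib's structure theorem for finitely generated modules over a PID.  That the
`p`-part of `Z(ℭ_j)⁻` (a quotient of the profinite group `lim Cl(ℭ_j pⁿ)`) is a finitely generated `ℤ_p`-module and
that its prime-to-`p` part is finite, the continuity of the splitting, and everything about Hecke characters stay
on paper (§A16 (b)).  Nothing here says anything about the status of the Hodge conjecture for CM abelian
varieties, which is NOT proved.
-/

set_option autoImplicit false

open Submodule

namespace Summit.Ventures.HodgeRepro.T3.TorsionSplit

section PID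

variable {R : Type*} [CommRing R] [IsDomain R] [IsPrincipalIdealRing R]
variable {M : Type*} [AddCommGroup M] [Module R M]

/-- **The splitting.** A finitely generated module over a PID is linearly isomorphic to the product of its torsion
submodule and a free module of finite rank: `0 → torsion R M → M → M ⧸ torsion R M → 0` is right split because
the quotient is torsion-free of finite type, hence free. -/
theorem exists_linearEquiv_torsion_prod_fin [Module.Finite R M] :
    ∃ n : ℕ, Nonempty (M ≃ₗ[R] torsion R M × (Fin n → R)) := by
  obtain ⟨n, g⟩ := Module.basisOfFiniteTypeTorsionFree' (R := R) (M := M ⧸ torsion R M)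
  obtain ⟨f, hf⟩ :=
    Module.projective_lifting_property _ LinearMap.id (torsion R M).mkQ_surjective
  refine ⟨n, ⟨(lequivProdOfRightSplitExact (torsion R M).injective_subtype ?_ hf).symm.trans
    (LinearEquiv.prodCongr (LinearEquiv.refl R _) g.equivFun)⟩⟩
  rw [range_subtype, ker_mkQ]

omit [IsPrincipalIdealRing R] in
/-- Under any linear isomorphism `M ≃ A × B` with `B` torsion-free, a torsion element of `M` has second component
`0`: the torsion sits inside the first factor. -/
theorem snd_eq_zero_of_mem_torsion {A B : Type*} [AddCommGroup A] [Module R A] [AddCommGroup B]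
    [Module R B] [Module.IsTorsionFree R B] (e : M ≃ₗ[R] A × B) {x : M}
    (hx : x ∈ torsion R M) : (e x).2 = 0 := by
  obtain ⟨a, ha⟩ := (mem_torsion_iff x).mp hx
  have ha' : (a : R) • x = 0 := ha
  have h : (a : R) • (e x).2 = 0 := by
    rw [← Prod.smul_snd, ← map_smul, ha', map_zero, Prod.snd_zero]
  exact (smul_eq_zero_iff_right (nonZeroDivisors.coe_ne_zero a)).mp h

end PID

section PadicInt

variable {p : ℕ} [hp : Fact p.Prime]

/-- `ℤ_p ⧸ (p^e)` is finite: it is `ℤ ⧸ p^e` through `PadicInt.toZModPow`. -/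
theorem finite_quotient_span_pow (e : ℕ) :
    Finite (ℤ_[p] ⧸ Ideal.span {(p : ℤ_[p]) ^ e}) := by
  rw [← PadicInt.ker_toZModPow e]
  exact Finite.of_equiv _
    (RingHom.quotientKerEquivOfSurjective
      (ZMod.ringHom_surjective (PadicInt.toZModPow (p := p) e))).symm.toEquiv

/-- `ℤ_p ⧸ (q^e)` is finite for every irreducible `q` of `ℤ_p`: every irreducible of the discrete valuation ring
`ℤ_p` is associated with `p`. -/
theorem finite_quotient_span_irreducible_pow {q : ℤ_[p]} (hq : Irreducible q) (e : ℕ) :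
    Finite (ℤ_[p] ⧸ Ideal.span {q ^ e}) := by
  have h : Ideal.span {q ^ e} = Ideal.span {(p : ℤ_[p]) ^ e} :=
    Ideal.span_singleton_eq_span_singleton.mpr
      (IsDiscreteValuationRing.associated_of_irreducible ℤ_[p] hq PadicInt.irreducible_p).pow_pow
  rw [h]
  exact finite_quotient_span_pow e

variable {M : Type*} [AddCommGroup M] [Module ℤ_[p] M]

/-- **`Δ` is finite.** The torsion submodule of a finitely generated `ℤ_p`-module is finite: it is finitely
generated (`ℤ_p` is Noetherian), hence by the structure theorem a finite direct sum of quotients `ℤ_p ⧸ (q^e)`,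
each finite. -/
theorem finite_torsion [Module.Finite ℤ_[p] M] : Finite (torsion ℤ_[p] M) := by
  obtain ⟨ι, _, q, hq, e, ⟨f⟩⟩ :=
    Module.equiv_directSum_of_isTorsion (R := ℤ_[p]) (M := torsion ℤ_[p] M) (torsion_isTorsion)
  haveI : ∀ i, Finite (ℤ_[p] ⧸ ℤ_[p] ∙ q i ^ e i) := fun i =>
    finite_quotient_span_irreducible_pow (hq i) (e i)
  haveI : Finite (DirectSum ι fun i => ℤ_[p] ⧸ ℤ_[p] ∙ q i ^ e i) :=
    Finite.of_equiv _ (DFinsupp.equivFunOnFintype (ι := ι)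
      (β := fun i => ℤ_[p] ⧸ ℤ_[p] ∙ q i ^ e i)).symm
  exact Finite.of_equiv _ f.symm.toEquiv

/-- **The splitting in the form `Tier3TorsionKill` consumes.** A finitely generated `ℤ_p`-module `M`, written
multiplicatively, is `Δ × Γ` with `Δ = Multiplicative (torsion ℤ_p M)` FINITE and
`Γ = Multiplicative (Fin n → ℤ_p)` torsion-free (`≅ ℤ_p^n`). -/
theorem exists_mulEquiv_multiplicative_torsion_prod_fin [Module.Finite ℤ_[p] M] :
    ∃ n : ℕ, Nonempty (Multiplicative M ≃*
      Multiplicative (torsion ℤ_[p] M) × Multiplicative (Fin n → ℤ_[p])) := by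
  obtain ⟨n, ⟨e⟩⟩ := exists_linearEquiv_torsion_prod_fin (R := ℤ_[p]) (M := M)
  exact ⟨n, ⟨(AddEquiv.toMultiplicative e.toAddEquiv).trans
    (MulEquiv.prodMultiplicative _ _)⟩⟩

/-- The multiplicative torsion factor is finite (the `[Finite Δ]` hypothesis of
`Tier3TorsionKill.deltaPart_pow_card`). -/
theorem finite_multiplicative_torsion [Module.Finite ℤ_[p] M] :
    Finite (Multiplicative (torsion ℤ_[p] M)) := by
  haveI := finite_torsion (p := p) (M := M)
  exact Finite.of_equiv _ Multiplicative.ofAdd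

end PadicInt

end Summit.Ventures.HodgeRepro.T3.TorsionSplit
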